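import Summits.AtomisticToContinuum.FouriersLaw.Theorems.BondHeatUncertaintyBoundedResponseBathHeatHeatReturn
import Summits.AtomisticToContinuum.FouriersLaw.Theorems.BondHeatUncertaintyBoundedResponseBathHeatHorizonReturnC
import HarnessLib

/-!
# BondHeatUncertainty / BoundedResponse — «Separation» §1: the LEVEL-SEPARATION VIOLATION `𝔙_T(L, g)`, the level clip, and ★★ the LEVEL BOUND
for NODE 110's thermal crossing defect (decomp-a2c lens-1, g114, NODE 114 «Separation / LevelSet»; part 1 of 3 — pure 1-D; the overview, the route
statements, tags, barriers and failure modes are in the main file `…BathHeatSeparation`; chain A → B → main; this file imports only the tree: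
NODE 111 `…BathHeatHeatReturn` and NODE 112 `…BathHeatHorizonReturnC`)

For a profile `g` on the thermal line `(ℝ, ν_T)`, `θ_T(k) = k² − T`, and a LEVEL `L`:
`hotDeficit_T(L,g) = ∫ (k²−T)⁺(L−g)⁺ dν_T`, `coldExcess_T(L,g) = ∫ (T−k²)⁺(g−L)⁺ dν_T`, `𝔙_T(L,g) = hotDeficit + coldExcess` (all `≥ 0`, blind to
`ν_T`-null changes); the level clip `g^{(L)} = max(g,L)` on `k² > T`, `min(g,L)` on `k² ≤ T` (`levelClip_cross`: it crosses the level `L` at `±√T`;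
`abs_sqSub_mul_abs_sub_levelClip`: `|θ_T||g − g^{(L)}| = (k²−T)⁺(L−g)⁺ + (T−k²)⁺(g−L)⁺`).
`levelViolation_eq_zero_of_separated` (`g ≥ L` on hot kicks, `≤ L` on cold kicks ⟹ all three vanish); `levelViolation_eq_zero_of_monotoneSq`
(nondecreasing in `k²` ⟹ separated at `g(√T)`); `hotCold_integrand_zero_eq` (level `0`: the integrand is `(θ_T g)⁻`);
★★ `thermalCrossDefect_le_levelViolation : 𝔇_T(g) ≤ 𝔙_T(L, g)` for EVERY `L` (`g` measurable, `θ_T g ∈ L¹(ν_T)`).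
No `sorry`, no new axioms; nothing here is a route statement.
-/

noncomputable section

open MeasureTheory ProbabilityTheory Filter Topology Set Function
open scoped NNReal ENNReal
open Literature.MathematicalPhysics.KineticTheory.HeatConduction
open Literature.MathematicalPhysics.KineticTheory OscillatorChain
open Literature.Probability.Process

namespace Summit.AtomisticToContinuum.FouriersLaw.Theorems.BoundedResponse.HeatSpreading

/-! ## §1 (NODE 114) The level-separation violation, the level clip, and ★★ the LEVEL BOUND for the crossing defect (pure 1-D) -/

section OneDimLevel

variable {T : ℝ}

/-- **HOT DEFICIT at level `L`**: `∫ (k² − T)⁺ · (L − g(k))⁺ dν_T` — the `θ_T`-weighted amount by which the profile `g` falls BELOW the level `L` on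
the hot kicks `k² > T`. [new · formal bookkeeping] -/
def hotDeficit (T L : ℝ) (g : ℝ → ℝ) : ℝ :=
  ∫ k, max (k ^ 2 - T) 0 * max (L - g k) 0 ∂(gaussianReal 0 T.toNNReal)

/-- **COLD EXCESS at level `L`**: `∫ (T − k²)⁺ · (g(k) − L)⁺ dν_T` — the `|θ_T|`-weighted amount by which `g` rises ABOVE `L` on the cold kicks
`k² < T` (a BOUNDED family of kicks). [new · formal bookkeeping] -/
def coldExcess (T L : ℝ) (g : ℝ → ℝ) : ℝ :=
  ∫ k, max (T - k ^ 2) 0 * max (g k - L) 0 ∂(gaussianReal 0 T.toNNReal)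

/-- **LEVEL-SEPARATION VIOLATION `𝔙_T(L, g) := hotDeficit + coldExcess`** — zero iff (a.e.) every cold kick's value is `≤ L ≤` every hot kick's value.
[new · formal bookkeeping] -/
def levelViolation (T L : ℝ) (g : ℝ → ℝ) : ℝ :=
  hotDeficit T L g + coldExcess T L g

/-- **The level clip** `g^{(L)}(k) := max(g(k), L)` on `k² > T`, `min(g(k), L)` on `k² ≤ T` — the pointwise-nearest curve crossing the level `L`
at the thermal momenta. [new · formal bookkeeping] -/
def levelClip (T L : ℝ) (g : ℝ → ℝ) (k : ℝ) : ℝ :=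
  if T < k ^ 2 then max (g k) L else min (g k) L

/-- `hotDeficit_nonneg` (docstring added by the landing lane; see the module docstring). [formal bookkeeping] -/
theorem hotDeficit_nonneg (T L : ℝ) (g : ℝ → ℝ) : 0 ≤ hotDeficit T L g :=
  integral_nonneg fun _ => mul_nonneg (le_max_right _ _) (le_max_right _ _)

/-- `coldExcess_nonneg` (docstring added by the landing lane; see the module docstring). [formal bookkeeping] -/
theorem coldExcess_nonneg (T L : ℝ) (g : ℝ → ℝ) : 0 ≤ coldExcess T L g :=
  integral_nonneg fun _ => mul_nonneg (le_max_right _ _) (le_max_right _ _)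

/-- `𝔙_T(L, g) ≥ 0`. [formal bookkeeping] -/
theorem levelViolation_nonneg (T L : ℝ) (g : ℝ → ℝ) : 0 ≤ levelViolation T L g :=
  add_nonneg (hotDeficit_nonneg T L g) (coldExcess_nonneg T L g)

/-- `𝔙_T(L, ·)` does not see `ν_T`-null modifications. [formal bookkeeping] -/
theorem levelViolation_congr_ae {g g' : ℝ → ℝ} (h : g =ᵐ[gaussianReal 0 T.toNNReal] g') (L : ℝ) :
    levelViolation T L g = levelViolation T L g' := by
  unfold levelViolation hotDeficit coldExcess
  congr 1
  · exact integral_congr_ae (by filter_upwards [h] with k hk; rw [hk])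
  · exact integral_congr_ae (by filter_upwards [h] with k hk; rw [hk])

/-- The same for the two halves. [formal bookkeeping] -/
theorem hotDeficit_congr_ae {g g' : ℝ → ℝ} (h : g =ᵐ[gaussianReal 0 T.toNNReal] g') (L : ℝ) :
    hotDeficit T L g = hotDeficit T L g' ∧ coldExcess T L g = coldExcess T L g' :=
  ⟨integral_congr_ae (by filter_upwards [h] with k hk; rw [hk]), integral_congr_ae (by filter_upwards [h] with k hk; rw [hk])⟩

/-- ★ **SEPARATED ⟹ VIOLATION ZERO**: if `g ≥ L` on the hot kicks and `g ≤ L` on the cold kicks then `𝔙_T(L, g) = 0` (both halves vanish; no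
measurability needed). [this cell] -/
theorem levelViolation_eq_zero_of_separated {g : ℝ → ℝ} {L : ℝ}
    (hhot : ∀ k : ℝ, T < k ^ 2 → L ≤ g k) (hcold : ∀ k : ℝ, k ^ 2 < T → g k ≤ L) :
    hotDeficit T L g = 0 ∧ coldExcess T L g = 0 ∧ levelViolation T L g = 0 := by
  have h1 : hotDeficit T L g = 0 := by
    unfold hotDeficit
    refine (integral_congr_ae (ae_of_all _ fun k => ?_)).trans (integral_zero ℝ ℝ)
    show max (k ^ 2 - T) 0 * max (L - g k) 0 = (0 : ℝ)
    rcases lt_or_ge T (k ^ 2) with h | h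
    · rw [max_eq_right (by linarith [hhot k h] : L - g k ≤ 0), mul_zero]
    · rw [max_eq_right (by linarith : k ^ 2 - T ≤ 0), zero_mul]
  have h2 : coldExcess T L g = 0 := by
    unfold coldExcess
    refine (integral_congr_ae (ae_of_all _ fun k => ?_)).trans (integral_zero ℝ ℝ)
    show max (T - k ^ 2) 0 * max (g k - L) 0 = (0 : ℝ)
    rcases lt_or_ge (k ^ 2) T with h | h
    · rw [max_eq_right (by linarith [hcold k h] : g k - L ≤ 0), mul_zero]
    · rw [max_eq_right (by linarith : T - k ^ 2 ≤ 0), zero_mul]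
  exact ⟨h1, h2, by unfold levelViolation; rw [h1, h2, add_zero]⟩

/-- ★ **MONOTONE ⟹ SEPARATED AT THE THERMAL-KICK LEVEL**: a curve nondecreasing in `k²` has `𝔙_T(R(√T), R) = 0` (`T ≥ 0`). [this cell] -/
theorem levelViolation_eq_zero_of_monotoneSq (hT : 0 ≤ T) {R : ℝ → ℝ} (hmono : ∀ k₁ k₂ : ℝ, k₁ ^ 2 ≤ k₂ ^ 2 → R k₁ ≤ R k₂) :
    levelViolation T (R (Real.sqrt T)) R = 0 :=
  (levelViolation_eq_zero_of_separated (T := T)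
    (fun k hk => hmono _ _ (by rw [Real.sq_sqrt hT]; exact hk.le))
    (fun k hk => hmono _ _ (by rw [Real.sq_sqrt hT]; exact hk.le))).2.2

/-- `(x)⁺ + (−x)⁺ = |x|`. [folklore] -/
theorem max_zero_add_max_neg_zero (x : ℝ) : max x 0 + max (-x) 0 = |x| := by
  rcases le_total 0 x with h | h
  · rw [max_eq_left h, max_eq_right (by linarith), abs_of_nonneg h, add_zero]
  · rw [max_eq_right h, max_eq_left (by linarith), abs_of_nonpos h, zero_add]

/-- ★ **LEVEL `0` = THE NEGATIVE PART OF THE FLOOR'S INTEGRAND**, pointwise: `(k²−T)⁺(−g)⁺ + (T−k²)⁺ g⁺ = (θ_T·g)⁻`. [this cell] -/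
theorem hotCold_integrand_zero_eq (T : ℝ) (g : ℝ → ℝ) (k : ℝ) :
    max (k ^ 2 - T) 0 * max (0 - g k) 0 + max (T - k ^ 2) 0 * max (g k - 0) 0 = max (-((k ^ 2 - T) * g k)) 0 := by
  rw [zero_sub, sub_zero]
  rcases le_total 0 (k ^ 2 - T) with hθ | hθ
  · rw [max_eq_left hθ, max_eq_right (by linarith : T - k ^ 2 ≤ 0), zero_mul, add_zero]
    rcases le_total 0 (g k) with hg | hg
    · rw [max_eq_right (by linarith : -g k ≤ 0), mul_zero, max_eq_right]
      exact neg_nonpos.2 (mul_nonneg hθ hg)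
    · rw [max_eq_left (by linarith : 0 ≤ -g k), max_eq_left (by nlinarith : 0 ≤ -((k ^ 2 - T) * g k))]
      ring
  · rw [max_eq_right hθ, max_eq_left (by linarith : 0 ≤ T - k ^ 2), zero_mul, zero_add]
    rcases le_total 0 (g k) with hg | hg
    · rw [max_eq_left hg, max_eq_left (by nlinarith : 0 ≤ -((k ^ 2 - T) * g k))]
      ring
    · rw [max_eq_right hg, mul_zero, max_eq_right]
      exact neg_nonpos.2 (mul_nonneg_of_nonpos_of_nonpos hθ hg)

/-- The level clip crosses the level `L` at `±√T`: `θ_T·(g^{(L)} − L) ≥ 0` everywhere. [this cell] -/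
theorem levelClip_cross (T L : ℝ) (g : ℝ → ℝ) (k : ℝ) : 0 ≤ (k ^ 2 - T) * (levelClip T L g k - (L + 0 * k)) := by
  unfold levelClip
  rw [zero_mul, add_zero]
  split_ifs with h
  · exact mul_nonneg (by linarith) (by linarith [le_max_right (g k) L])
  · push Not at h
    exact mul_nonneg_of_nonpos_of_nonpos (by linarith) (by linarith [min_le_right (g k) L])

/-- `|g^{(L)}| ≤ |g| + |L|`. [formal bookkeeping] -/
theorem abs_levelClip_le (T L : ℝ) (g : ℝ → ℝ) (k : ℝ) : |levelClip T L g k| ≤ |g k| + |L| := by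
  unfold levelClip
  split_ifs
  · rcases max_choice (g k) L with h | h <;> rw [h] <;> linarith [abs_nonneg (g k), abs_nonneg L]
  · rcases min_choice (g k) L with h | h <;> rw [h] <;> linarith [abs_nonneg (g k), abs_nonneg L]

/-- ★ **THE CLIP IS THE POINTWISE-NEAREST LEVEL-CROSSING CURVE**: `|θ_T|·|g − g^{(L)}| = (k²−T)⁺(L−g)⁺ + (T−k²)⁺(g−L)⁺`. [this cell] -/
theorem abs_sqSub_mul_abs_sub_levelClip (T L : ℝ) (g : ℝ → ℝ) (k : ℝ) :
    |k ^ 2 - T| * |g k - levelClip T L g k| =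
      max (k ^ 2 - T) 0 * max (L - g k) 0 + max (T - k ^ 2) 0 * max (g k - L) 0 := by
  unfold levelClip
  split_ifs with h
  · rw [max_eq_left (by linarith : 0 ≤ k ^ 2 - T), max_eq_right (by linarith : T - k ^ 2 ≤ 0), zero_mul, add_zero,
      abs_of_pos (by linarith : 0 < k ^ 2 - T)]
    congr 1
    rcases le_total (g k) L with hgl | hgl
    · rw [max_eq_right hgl, max_eq_left (by linarith : 0 ≤ L - g k), abs_of_nonpos (by linarith : g k - L ≤ 0)]
      ring
    · rw [max_eq_left hgl, max_eq_right (by linarith : L - g k ≤ 0), sub_self, abs_zero]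
  · push Not at h
    rw [max_eq_right (by linarith : k ^ 2 - T ≤ 0), max_eq_left (by linarith : 0 ≤ T - k ^ 2), zero_mul, zero_add,
      abs_of_nonpos (by linarith : k ^ 2 - T ≤ 0)]
    rcases le_total (g k) L with hgl | hgl
    · rw [min_eq_left hgl, max_eq_right (by linarith : g k - L ≤ 0), sub_self, abs_zero, mul_zero, mul_zero]
    · rw [min_eq_right hgl, max_eq_left (by linarith : 0 ≤ g k - L), abs_of_nonneg (by linarith : 0 ≤ g k - L)]
      ring

/-- `measurable_levelClip` (docstring added by the landing lane; see the module docstring). [formal bookkeeping] -/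
theorem measurable_levelClip (T L : ℝ) {g : ℝ → ℝ} (hg : Measurable g) : Measurable (levelClip T L g) :=
  Measurable.ite (measurableSet_lt measurable_const (measurable_id.pow_const 2)) (hg.max measurable_const)
    (hg.min measurable_const)

/-- `θ_T·g^{(L)} ∈ L¹(ν_T)` whenever `θ_T·g ∈ L¹(ν_T)`. [formal bookkeeping] -/
theorem integrable_sqSub_mul_levelClip {g : ℝ → ℝ} (hgm : Measurable g)
    (hg : Integrable (fun k : ℝ => (k ^ 2 - T) * g k) (gaussianReal 0 T.toNNReal)) (L : ℝ) :
    Integrable (fun k : ℝ => (k ^ 2 - T) * levelClip T L g k) (gaussianReal 0 T.toNNReal) := by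
  refine Integrable.mono' (hg.abs.add ((gaussT_integrable_sqSub T).abs.mul_const |L|)) ?_ (ae_of_all _ fun k => ?_)
  · exact (((measurable_id.pow_const 2).sub measurable_const).mul (measurable_levelClip T L hgm)).aestronglyMeasurable
  · simp only [Pi.add_apply, Real.norm_eq_abs, abs_mul]
    calc |k ^ 2 - T| * |levelClip T L g k| ≤ |k ^ 2 - T| * (|g k| + |L|) :=
          mul_le_mul_of_nonneg_left (abs_levelClip_le T L g k) (abs_nonneg _)
      _ = |k ^ 2 - T| * |g k| + |k ^ 2 - T| * |L| := by ring

/-- The two violation integrands are integrable (dominated by `|θ_T g| + |θ_T|·|L|`). [formal bookkeeping] -/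
theorem integrable_hotCold_integrands {g : ℝ → ℝ} (hgm : Measurable g)
    (hg : Integrable (fun k : ℝ => (k ^ 2 - T) * g k) (gaussianReal 0 T.toNNReal)) (L : ℝ) :
    Integrable (fun k : ℝ => max (k ^ 2 - T) 0 * max (L - g k) 0) (gaussianReal 0 T.toNNReal) ∧
      Integrable (fun k : ℝ => max (T - k ^ 2) 0 * max (g k - L) 0) (gaussianReal 0 T.toNNReal) := by
  have hθ : Measurable fun k : ℝ => k ^ 2 - T := (measurable_id.pow_const 2).sub measurable_const
  have hθ' : Measurable fun k : ℝ => T - k ^ 2 := measurable_const.sub (measurable_id.pow_const 2)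
  have hdom : Integrable (fun k : ℝ => |(k ^ 2 - T) * g k| + |k ^ 2 - T| * |L|) (gaussianReal 0 T.toNNReal) :=
    hg.abs.add ((gaussT_integrable_sqSub T).abs.mul_const |L|)
  have hb1 : ∀ k : ℝ, max (L - g k) 0 ≤ |g k| + |L| := fun k =>
    max_le (by linarith [neg_abs_le (g k), le_abs_self L]) (by positivity)
  have hb2 : ∀ k : ℝ, max (g k - L) 0 ≤ |g k| + |L| := fun k =>
    max_le (by linarith [le_abs_self (g k), neg_abs_le L]) (by positivity)
  constructor
  · refine Integrable.mono' hdom ((hθ.max measurable_const).mul ((measurable_const.sub hgm).max measurable_const)).aestronglyMeasurable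
      (ae_of_all _ fun k => ?_)
    rw [Real.norm_eq_abs, abs_of_nonneg (mul_nonneg (le_max_right _ _) (le_max_right _ _))]
    calc max (k ^ 2 - T) 0 * max (L - g k) 0 ≤ |k ^ 2 - T| * (|g k| + |L|) :=
          mul_le_mul (max_le (le_abs_self _) (abs_nonneg _)) (hb1 k) (le_max_right _ _) (abs_nonneg _)
      _ = |(k ^ 2 - T) * g k| + |k ^ 2 - T| * |L| := by rw [abs_mul]; ring
  · refine Integrable.mono' hdom ((hθ'.max measurable_const).mul ((hgm.sub measurable_const).max measurable_const)).aestronglyMeasurable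
      (ae_of_all _ fun k => ?_)
    rw [Real.norm_eq_abs, abs_of_nonneg (mul_nonneg (le_max_right _ _) (le_max_right _ _))]
    have hTk : max (T - k ^ 2) 0 ≤ |k ^ 2 - T| := max_le (by rw [abs_sub_comm]; exact le_abs_self _) (abs_nonneg _)
    calc max (T - k ^ 2) 0 * max (g k - L) 0 ≤ |k ^ 2 - T| * (|g k| + |L|) :=
          mul_le_mul hTk (hb2 k) (le_max_right _ _) (abs_nonneg _)
      _ = |(k ^ 2 - T) * g k| + |k ^ 2 - T| * |L| := by rw [abs_mul]; ring

/-- `𝔙_T(L, g)` as ONE integral. [formal bookkeeping] -/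
theorem levelViolation_eq_integral {g : ℝ → ℝ} (hgm : Measurable g)
    (hg : Integrable (fun k : ℝ => (k ^ 2 - T) * g k) (gaussianReal 0 T.toNNReal)) (L : ℝ) :
    levelViolation T L g =
      ∫ k, (max (k ^ 2 - T) 0 * max (L - g k) 0 + max (T - k ^ 2) 0 * max (g k - L) 0) ∂(gaussianReal 0 T.toNNReal) := by
  obtain ⟨h1, h2⟩ := integrable_hotCold_integrands hgm hg L
  unfold levelViolation hotDeficit coldExcess
  rw [integral_add h1 h2]

/-- ★ `∫ |θ_T|·|g − g^{(L)}| dν_T = 𝔙_T(L, g)`. [this cell] -/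
theorem integral_abs_sub_levelClip {g : ℝ → ℝ} (hgm : Measurable g)
    (hg : Integrable (fun k : ℝ => (k ^ 2 - T) * g k) (gaussianReal 0 T.toNNReal)) (L : ℝ) :
    ∫ k, |k ^ 2 - T| * |g k - levelClip T L g k| ∂(gaussianReal 0 T.toNNReal) = levelViolation T L g := by
  rw [levelViolation_eq_integral hgm hg L]
  exact integral_congr_ae (ae_of_all _ fun k => abs_sqSub_mul_abs_sub_levelClip T L g k)

/-- ★★ **THE LEVEL BOUND FOR THE CROSSING DEFECT**: `𝔇_T(g) ≤ 𝔙_T(L, g)` for EVERY level `L` (`g` measurable, `θ_T·g ∈ L¹(ν_T)`). No evenness,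
no monotonicity, no window. [this cell] -/
theorem thermalCrossDefect_le_levelViolation {g : ℝ → ℝ} (hgm : Measurable g)
    (hg : Integrable (fun k : ℝ => (k ^ 2 - T) * g k) (gaussianReal 0 T.toNNReal)) (L : ℝ) :
    thermalCrossDefect T g ≤ levelViolation T L g := by
  rw [← integral_abs_sub_levelClip hgm hg L]
  exact thermalCrossDefect_le (a := L) (b := 0) (levelClip_cross T L g) (integrable_sqSub_mul_levelClip hgm hg L)

end OneDimLevel

end Summit.AtomisticToContinuum.FouriersLaw.Theorems.BoundedResponse.HeatSpreading

end
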